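import Summits.QuantumFields.YangMills.Theorems.BalabanUVNodesN07ShearSizeTopBoxChartA
import Summits.QuantumFields.YangMills.Theorems.BalabanUVNodesN07ShearSizeTopBoxTowerGauge
import HarnessLib

/-!
# DAG node N07 [B11] — road R0′ rows (r1)+(r4) AT THE RECORD, EVERY DISPLAYED LETTER OF THE LINEAGE SUPPLIED: the Landau copy's letter `a := 60ℓLR` from dag-n07-w2's chart dictionary
# (this base's `…ChartA`) AND module 40's data identity `hdata` from the tower gauge `u := h̄·u₀` (this base's `…TowerGauge`) — the composed row's inputs are now exactly: the Landau copy
# `U₁` READ in the weighted-ball chart on a family `D` whose index bonds contain the box bonds, the (7)-smallness of the representative's own level-`j` data on the box plaquettes, the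
# box geometry and the two thresholds; plus the per-datum capstone on the TOP CUBE of dag-n07-e's cube tower (`hbox` discharged)

Cell `pub-ymgap` (HUMAN RULINGS D-0062 ∕ D-0088 ∕ D-0149), width seat `pub-ymgap-dag-n07-w6` (second wave), harness re-seat g0″, 2026-08-28; FILE 3 of this generation (own lineage, composition of
FILE 1 + FILE 2).  `--kind proof --supports stmt-QuantumFields-27364 --as helper` (K1⁹ per dag-lead KEY MAP v2; count-neutral).  THEOREMS ONLY.

THE PRINT.  [B11] = [15] `[Balaban1985Variational]` pp. 300–303: Sect. F's first step (the axial tower), (147) (the data re-gauged axially on the top cube), (151)–(152) (the sizes of the data and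
of the Landau copy `U₁ = e^{iηA}`), (154)–(156) (the sheared datum in logarithmic letters), (160) first case.

WHAT THIS FILE DOES (two `exact`s; NOTHING of [B11]∕[15]∕[6]∕[3] analysis asserted).
* ★★★★ `norm_mlog_iter_avOfRecord_centred_sub_le_supplied` — `…TowerGauge.norm_mlog_iter_avOfRecord_centred_sub_le_towerGauge` with its letter `a` supplied by
  `…ChartA.dist1_iter_avOfRecord_le_of_chart_box` (`a := 60ℓLR`): on every box bond `c`, `‖log M^j(U₁)(c) − (log V♮(c) + (log ĝ(c₋)⁻¹ − log ĝ(c₊)⁻¹))‖ ≤ 8σ♮² + 20σ♮·(d−1)nδ`,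
  `σ♮ := D♮·((d−1)nδ + 60ℓLR)`, at the gauge `u := h̄·u₀`, `h := axialGauge (M^j(U₁^{u₀})) lo hi` — NO `hdata`, NO bond letter displayed.
* ★★★★ `norm_mlog_iter_avOfRecord_centred_sub_le_supplied_of_rep` — THE KNIT'S SHAPE: for ANY tower representative `U′` and ANY pair `(u, U₁)` with `U₁^{u} = U′^{h̄}` (`hrep`, [6] Thm 2's
  Landau copy) READ in the chart: the row with `v := (d−1)nδ` (smallness asked of `M^j U′`) and `a := 60ℓLR`.
* ★ `norm_mlog_iter_avOfRecord_centred_sub_le_supplied_of_isBackground` — keyed on a minimiser of record `U₁^{u₀}` over data `V` (`IsBackground (avOfRecord F N K) (bgReg …) j V`).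
* ★★★ `norm_mlog_iter_avOfRecord_centred_sub_le_supplied_cubeTop` — the per-datum capstone on the TOP CUBE `[sqLo k, sqHi k]` of `cubeDomains (F.P K) a M ρ k hk` with the chart keyed on the
  tower itself: `hbox` DISCHARGED (`…ChartA.hbox_cubeDomains_top`); displayed: the tower's collar, the chart binders, the (7)-smallness of `M^k(U₁^{u₀})` on the top cube's plaquettes,
  extent∕non-wrapping, thresholds; ★★★★ `norm_mlog_iter_avOfRecord_centred_sub_le_supplied_of_rep_cubeTop` — the same in the knit's shape (`U′`, `hrep`).

HONEST FRAMING (binding).  Count-neutral helper; composition of this base's FILE 1 ∕ FILE 2 by name; the Landau copy `U₁` of [6] Thm 2, its gauge `u₀` and the chart datum `A` are BINDERS, NOT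
constructed; nothing of [B11]∕[15]∕[6]∕[3] analysis asserted; BRIDGE-92-B stays GAP-STATED until the S6 head knits (r0)–(r4); `stub_prop8StepCoP13` ∕ K0⁷ ∕ K1⁹ NOT closed; N07 NOT discharged;
the chair's tally of record is the only count; **no summit statement is proved by this seat** — one finite `T⁴` programme at fixed `ε`, Bałaban AS PRINTED; the route closes the conditional
finite-𝕋⁴ rung `BalabanLadder.UV` only; NOT continuum ∕ ℝ⁴ ∕ OS ∕ mass gap ∕ Clay.  No `sorry`, no `def`, no `instance`, no `notation`.
-/

noncomputable section

namespace Summit.QuantumFields.YangMills.BalabanUVNodes.N07ShearSizeTopBoxSupplied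

open scoped Matrix.Norms.L2Operator
open Literature.MathematicalPhysics.QuantumFieldTheory.Balaban1983to89
open Literature.MathematicalPhysics.QuantumFieldTheory.Balaban1983to89.Node00
open T4Continuum
open T4AxialGaugeSmallField (castSite axialGauge boxPlaqs)
open B6SectADomainsV1 (Domains)
open B8Eq131Cubes (sqLo sqHi)
open B14DomainGeom (Pt)
open B16Sect1Backgrounds (toMS)
open B15Eq177GaugeInvariance (blockLift)
open GaugeField (gaugeAct)
open ExpMeanLog (deltaSU)
open MatrixLog (mlog)
open Summit.QuantumFields.YangMills.Theorems.Prop8Chart (expCfg)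
open Summit.QuantumFields.YangMills.Theorems.K0FlatCubeOpsTextP (IsLevWeight)
open Summit.QuantumFields.YangMills.BalabanUVNodes.N07ShearSizeTopBoxChartA (dist1_iter_avOfRecord_le_of_chart_box chart_letter_nonneg hbox_cubeDomains_top)
open Summit.QuantumFields.YangMills.BalabanUVNodes.N07ShearSizeTopBoxTowerGauge (norm_mlog_iter_avOfRecord_centred_sub_le_towerGauge norm_mlog_iter_avOfRecord_centred_sub_le_of_rep)

variable (F : T4Continuum.T4Family) (N : ℕ) [NeZero N]

/-- ★★★★ **ROWS (r1)+(r4) AT THE RECORD — `a` FROM THE CHART, `hdata` FROM THE TOWER GAUGE, NOTHING ELSE DISPLAYED.**  Torus `K`, level `j ≤ m + K`, box `[lo, hi]` of `T^{(j)}` with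
`hi ≤ lo + n`, non-wrapping `n + 1 < N_j`; a nested family `D` (`D.k = k`, collar, weights `IsLevWeight (F.P K) k D w`) whose level-`j` index bonds contain the box bonds (`hbox`); the Landau copy
`U₁` READ in the weighted-ball chart (`w₁‖A‖ < R`, `12800ℓ²LR ≤ 1`, `60ℓ²LR < δ_N`, `hUA`); any gauge `u₀` whose representative's level-`j` data `M^j(U₁^{u₀})` has `δ`-small plaquettes based in the
box.  Then at `u := h̄·u₀`, `h := axialGauge (M^j(U₁^{u₀})) lo hi`, with `σ♮ := D♮·((d−1)nδ + 60ℓLR) ≤ 1∕80` and `(d−1)nδ ≤ 1∕40`, on every box bond `c`: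
`‖log M^j(U₁)(c) − (log V♮(c) + (log ĝ(c₋)⁻¹ − log ĝ(c₊)⁻¹))‖ ≤ 8σ♮² + 20σ♮·(d−1)nδ`. [cite: Balaban1985Variational, (147) p.301, (151)–(156) pp.301–302, (160) p.303] -/
theorem norm_mlog_iter_avOfRecord_centred_sub_le_supplied (K k : ℕ) (D : Domains (F.P K)) (hDk : D.k = k)
    (hcollar : ∀ (i : ℕ) (e : PBond (F.P K) (i + 1)), D.LamBond (i + 1) e → ∀ z : Site (F.P K) i, (blockOf z = e.src ∨ blockOf z = e.tgt) → z ∈ D.Om i)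
    {w : ℕ → PBond (F.P K) 0 → ℝ} (hw : IsLevWeight (F.P K) k D w) {R : ℝ}
    (hR : 12800 * ((((F.P K).d + 2) * (F.P K).L : ℕ) : ℝ) ^ 2 * ((F.P K).L : ℝ) * R ≤ 1)
    (hguard : 60 * ((((F.P K).d + 2) * (F.P K).L : ℕ) : ℝ) ^ 2 * ((F.P K).L : ℝ) * R < deltaSU (Fin N))
    {A : PBond (F.P K) 0 → MatA N} (hA : ∀ b, w 1 b * ‖A b‖ < R)
    (u₀ : GaugeTransf (F.P K) 0 (SU N)) (U₁ : GaugeField (F.P K) 0 (SU N))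
    (hUA : ∀ b, ((U₁ b : SU N) : MatA N) = ((expCfg ((((F.P K).L : ℝ)⁻¹) ^ k) A b : (MatA N)ˣ) : MatA N))
    {j : ℕ} (hj : j ≤ (F.P K).m + (F.P K).K) {lo hi : Fin (F.P K).d → ℤ} {n : ℕ} (hn : ∀ κ, hi κ ≤ lo κ + n) (hnN : n + 1 < (F.P K).sitesPerDir j)
    (hbox : ∀ c : PBond (F.P K) j, c.src ∈ (castSite '' Set.Icc lo hi : Set (Site (F.P K) j)) → c.tgt ∈ (castSite '' Set.Icc lo hi : Set (Site (F.P K) j)) → D.LamBond j c)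
    {δ : ℝ} {S₀ : Set (Plaq (F.P K) j)} (hS₀ : boxPlaqs lo hi ⊆ S₀) (hV : PlaqSmallOn S₀ δ (Averaging.iter (avOfRecord F N K) j (gaugeAct u₀ U₁))) (hδ : 0 ≤ δ)
    (hσ : ((∑ κ, (hi κ - lo κ).toNat : ℕ) : ℝ) * ((((F.P K).d - 1 : ℕ) : ℝ) * n * δ + 60 * ((((F.P K).d + 2) * (F.P K).L : ℕ) : ℝ) * ((F.P K).L : ℝ) * R) ≤ 1 / 80)
    (hv40 : (((F.P K).d - 1 : ℕ) : ℝ) * n * δ ≤ 1 / 40)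
    {c : PBond (F.P K) j} (hs : c.src ∈ (castSite '' Set.Icc lo hi : Set (Site (F.P K) j))) (ht : c.tgt ∈ (castSite '' Set.Icc lo hi : Set (Site (F.P K) j))) :
    ‖mlog ((Averaging.iter (avOfRecord F N K) j U₁ c : SU N) : MatA N) -
        (mlog ((((toMS (fun x => blockLift j (axialGauge (Averaging.iter (avOfRecord F N K) j (gaugeAct u₀ U₁)) lo hi) x * u₀ x) j (castSite lo))⁻¹ *
              Averaging.iter (avOfRecord F N K) j
                (gaugeAct (fun x => blockLift j (axialGauge (Averaging.iter (avOfRecord F N K) j (gaugeAct u₀ U₁)) lo hi) x * u₀ x) U₁) c *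
              toMS (fun x => blockLift j (axialGauge (Averaging.iter (avOfRecord F N K) j (gaugeAct u₀ U₁)) lo hi) x * u₀ x) j (castSite lo) : SU N)) : MatA N) +
          (mlog (((((toMS (fun x => blockLift j (axialGauge (Averaging.iter (avOfRecord F N K) j (gaugeAct u₀ U₁)) lo hi) x * u₀ x) j (castSite lo))⁻¹ *
                toMS (fun x => blockLift j (axialGauge (Averaging.iter (avOfRecord F N K) j (gaugeAct u₀ U₁)) lo hi) x * u₀ x) j c.src)⁻¹ : SU N)) : MatA N) -
            mlog (((((toMS (fun x => blockLift j (axialGauge (Averaging.iter (avOfRecord F N K) j (gaugeAct u₀ U₁)) lo hi) x * u₀ x) j (castSite lo))⁻¹ *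
                toMS (fun x => blockLift j (axialGauge (Averaging.iter (avOfRecord F N K) j (gaugeAct u₀ U₁)) lo hi) x * u₀ x) j c.tgt)⁻¹ : SU N)) : MatA N)))‖ ≤
      8 * (((∑ κ, (hi κ - lo κ).toNat : ℕ) : ℝ) * ((((F.P K).d - 1 : ℕ) : ℝ) * n * δ + 60 * ((((F.P K).d + 2) * (F.P K).L : ℕ) : ℝ) * ((F.P K).L : ℝ) * R)) ^ 2 +
        20 * (((∑ κ, (hi κ - lo κ).toNat : ℕ) : ℝ) * ((((F.P K).d - 1 : ℕ) : ℝ) * n * δ + 60 * ((((F.P K).d + 2) * (F.P K).L : ℕ) : ℝ) * ((F.P K).L : ℝ) * R)) *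
          ((((F.P K).d - 1 : ℕ) : ℝ) * n * δ) :=
  norm_mlog_iter_avOfRecord_centred_sub_le_towerGauge F N K u₀ U₁ hj hn hnN hS₀ hV hδ (chart_letter_nonneg F N K k D hw hA ⟨fun _ => 0, c.dir⟩)
    (dist1_iter_avOfRecord_le_of_chart_box F N K k D hDk hcollar hw hR hguard hA U₁ hUA hbox) hσ hv40 hs ht

/-- ★★★★ **THE KNIT-SHAPED EDITION — rows (r1)+(r4) at the record for [6] Thm 2's pair `(u, U₁)` over the tower representative `U′`, EVERYTHING SUPPLIED**: `U′` any configuration (the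
axial-tower representative of the minimiser of record), `V := M^j(U′)` with `δ`-small plaquettes based in the box, `h := axialGauge V lo hi`; the pair `(u, U₁)` with `U₁^{u} = U′^{h̄}` (`hrep`)
and `U₁` READ in the weighted-ball chart on a family `D` whose level-`j` index bonds contain the box bonds.  Then with `σ♮ := D♮·((d−1)nδ + 60ℓLR) ≤ 1∕80`, `(d−1)nδ ≤ 1∕40`, on every box bond:
`‖log M^j(U₁)(c) − (log V♮(c) + (log ĝ(c₋)⁻¹ − log ĝ(c₊)⁻¹))‖ ≤ 8σ♮² + 20σ♮·(d−1)nδ` — FILE 2's `…_of_rep` with `a := 60ℓLR` from FILE 1.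
[cite: Balaban1985Variational, (147) p.301, (151)–(156) pp.301–302, (160) p.303] -/
theorem norm_mlog_iter_avOfRecord_centred_sub_le_supplied_of_rep (K k : ℕ) (D : Domains (F.P K)) (hDk : D.k = k)
    (hcollar : ∀ (i : ℕ) (e : PBond (F.P K) (i + 1)), D.LamBond (i + 1) e → ∀ z : Site (F.P K) i, (blockOf z = e.src ∨ blockOf z = e.tgt) → z ∈ D.Om i)
    {w : ℕ → PBond (F.P K) 0 → ℝ} (hw : IsLevWeight (F.P K) k D w) {R : ℝ}
    (hR : 12800 * ((((F.P K).d + 2) * (F.P K).L : ℕ) : ℝ) ^ 2 * ((F.P K).L : ℝ) * R ≤ 1)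
    (hguard : 60 * ((((F.P K).d + 2) * (F.P K).L : ℕ) : ℝ) ^ 2 * ((F.P K).L : ℝ) * R < deltaSU (Fin N))
    {A : PBond (F.P K) 0 → MatA N} (hA : ∀ b, w 1 b * ‖A b‖ < R)
    (U' : GaugeField (F.P K) 0 (SU N)) (u : GaugeTransf (F.P K) 0 (SU N)) (U₁ : GaugeField (F.P K) 0 (SU N))
    (hUA : ∀ b, ((U₁ b : SU N) : MatA N) = ((expCfg ((((F.P K).L : ℝ)⁻¹) ^ k) A b : (MatA N)ˣ) : MatA N))
    {j : ℕ} (hj : j ≤ (F.P K).m + (F.P K).K) {lo hi : Fin (F.P K).d → ℤ} {n : ℕ} (hn : ∀ κ, hi κ ≤ lo κ + n) (hnN : n + 1 < (F.P K).sitesPerDir j)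
    (hrep : gaugeAct u U₁ = gaugeAct (blockLift j (axialGauge (Averaging.iter (avOfRecord F N K) j U') lo hi)) U')
    (hbox : ∀ c : PBond (F.P K) j, c.src ∈ (castSite '' Set.Icc lo hi : Set (Site (F.P K) j)) → c.tgt ∈ (castSite '' Set.Icc lo hi : Set (Site (F.P K) j)) → D.LamBond j c)
    {δ : ℝ} {S₀ : Set (Plaq (F.P K) j)} (hS₀ : boxPlaqs lo hi ⊆ S₀) (hV : PlaqSmallOn S₀ δ (Averaging.iter (avOfRecord F N K) j U')) (hδ : 0 ≤ δ)
    (hσ : ((∑ κ, (hi κ - lo κ).toNat : ℕ) : ℝ) * ((((F.P K).d - 1 : ℕ) : ℝ) * n * δ + 60 * ((((F.P K).d + 2) * (F.P K).L : ℕ) : ℝ) * ((F.P K).L : ℝ) * R) ≤ 1 / 80)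
    (hv40 : (((F.P K).d - 1 : ℕ) : ℝ) * n * δ ≤ 1 / 40)
    {c : PBond (F.P K) j} (hs : c.src ∈ (castSite '' Set.Icc lo hi : Set (Site (F.P K) j))) (ht : c.tgt ∈ (castSite '' Set.Icc lo hi : Set (Site (F.P K) j))) :
    ‖mlog ((Averaging.iter (avOfRecord F N K) j U₁ c : SU N) : MatA N) -
        (mlog ((((toMS u j (castSite lo))⁻¹ * Averaging.iter (avOfRecord F N K) j (gaugeAct u U₁) c * toMS u j (castSite lo) : SU N)) : MatA N) +
          (mlog (((((toMS u j (castSite lo))⁻¹ * toMS u j c.src)⁻¹ : SU N)) : MatA N) -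
            mlog (((((toMS u j (castSite lo))⁻¹ * toMS u j c.tgt)⁻¹ : SU N)) : MatA N)))‖ ≤
      8 * (((∑ κ, (hi κ - lo κ).toNat : ℕ) : ℝ) * ((((F.P K).d - 1 : ℕ) : ℝ) * n * δ + 60 * ((((F.P K).d + 2) * (F.P K).L : ℕ) : ℝ) * ((F.P K).L : ℝ) * R)) ^ 2 +
        20 * (((∑ κ, (hi κ - lo κ).toNat : ℕ) : ℝ) * ((((F.P K).d - 1 : ℕ) : ℝ) * n * δ + 60 * ((((F.P K).d + 2) * (F.P K).L : ℕ) : ℝ) * ((F.P K).L : ℝ) * R)) *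
          ((((F.P K).d - 1 : ℕ) : ℝ) * n * δ) :=
  norm_mlog_iter_avOfRecord_centred_sub_le_of_rep F N K U' u U₁ hj hn hnN hrep hS₀ hV hδ (chart_letter_nonneg F N K k D hw hA ⟨fun _ => 0, c.dir⟩)
    (dist1_iter_avOfRecord_le_of_chart_box F N K k D hDk hcollar hw hR hguard hA U₁ hUA hbox) hσ hv40 hs ht

/-- ★ **The same keyed on a MINIMISER OF RECORD**: if `U₁^{u₀}` minimises the Wilson action of record over data `V` in `bgReg` (`IsBackground (avOfRecord F N K) (bgReg F N K j ε) j V`), then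
`M^j(U₁^{u₀}) = V` literally, the smallness is asked of `V`, and the row reads at `u := h̄·u₀` with `h := axialGauge V lo hi` (by FILE 2's `isBackground_towerGauge`, `U₁^{u}` minimises over `V^h`).
[cite: Balaban1985Variational, (144)–(147) pp.300–301, (151)–(156) pp.301–302, (160) p.303] -/
theorem norm_mlog_iter_avOfRecord_centred_sub_le_supplied_of_isBackground (K k : ℕ) (D : Domains (F.P K)) (hDk : D.k = k)
    (hcollar : ∀ (i : ℕ) (e : PBond (F.P K) (i + 1)), D.LamBond (i + 1) e → ∀ z : Site (F.P K) i, (blockOf z = e.src ∨ blockOf z = e.tgt) → z ∈ D.Om i)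
    {w : ℕ → PBond (F.P K) 0 → ℝ} (hw : IsLevWeight (F.P K) k D w) {R : ℝ}
    (hR : 12800 * ((((F.P K).d + 2) * (F.P K).L : ℕ) : ℝ) ^ 2 * ((F.P K).L : ℝ) * R ≤ 1)
    (hguard : 60 * ((((F.P K).d + 2) * (F.P K).L : ℕ) : ℝ) ^ 2 * ((F.P K).L : ℝ) * R < deltaSU (Fin N))
    {A : PBond (F.P K) 0 → MatA N} (hA : ∀ b, w 1 b * ‖A b‖ < R)
    (u₀ : GaugeTransf (F.P K) 0 (SU N)) (U₁ : GaugeField (F.P K) 0 (SU N))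
    (hUA : ∀ b, ((U₁ b : SU N) : MatA N) = ((expCfg ((((F.P K).L : ℝ)⁻¹) ^ k) A b : (MatA N)ˣ) : MatA N))
    {j : ℕ} (hj : j ≤ (F.P K).m + (F.P K).K) {ε : ℝ} {V : GaugeField (F.P K) j (SU N)}
    (hbg : IsBackground (avOfRecord F N K) (bgReg F N K j ε) j V (gaugeAct u₀ U₁))
    {lo hi : Fin (F.P K).d → ℤ} {n : ℕ} (hn : ∀ κ, hi κ ≤ lo κ + n) (hnN : n + 1 < (F.P K).sitesPerDir j)
    (hbox : ∀ c : PBond (F.P K) j, c.src ∈ (castSite '' Set.Icc lo hi : Set (Site (F.P K) j)) → c.tgt ∈ (castSite '' Set.Icc lo hi : Set (Site (F.P K) j)) → D.LamBond j c)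
    {δ : ℝ} {S₀ : Set (Plaq (F.P K) j)} (hS₀ : boxPlaqs lo hi ⊆ S₀) (hV : PlaqSmallOn S₀ δ V) (hδ : 0 ≤ δ)
    (hσ : ((∑ κ, (hi κ - lo κ).toNat : ℕ) : ℝ) * ((((F.P K).d - 1 : ℕ) : ℝ) * n * δ + 60 * ((((F.P K).d + 2) * (F.P K).L : ℕ) : ℝ) * ((F.P K).L : ℝ) * R) ≤ 1 / 80)
    (hv40 : (((F.P K).d - 1 : ℕ) : ℝ) * n * δ ≤ 1 / 40)
    {c : PBond (F.P K) j} (hs : c.src ∈ (castSite '' Set.Icc lo hi : Set (Site (F.P K) j))) (ht : c.tgt ∈ (castSite '' Set.Icc lo hi : Set (Site (F.P K) j))) :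
    ‖mlog ((Averaging.iter (avOfRecord F N K) j U₁ c : SU N) : MatA N) -
        (mlog ((((toMS (fun x => blockLift j (axialGauge V lo hi) x * u₀ x) j (castSite lo))⁻¹ *
              Averaging.iter (avOfRecord F N K) j (gaugeAct (fun x => blockLift j (axialGauge V lo hi) x * u₀ x) U₁) c *
              toMS (fun x => blockLift j (axialGauge V lo hi) x * u₀ x) j (castSite lo) : SU N)) : MatA N) +
          (mlog (((((toMS (fun x => blockLift j (axialGauge V lo hi) x * u₀ x) j (castSite lo))⁻¹ *
                toMS (fun x => blockLift j (axialGauge V lo hi) x * u₀ x) j c.src)⁻¹ : SU N)) : MatA N) -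
            mlog (((((toMS (fun x => blockLift j (axialGauge V lo hi) x * u₀ x) j (castSite lo))⁻¹ *
                toMS (fun x => blockLift j (axialGauge V lo hi) x * u₀ x) j c.tgt)⁻¹ : SU N)) : MatA N)))‖ ≤
      8 * (((∑ κ, (hi κ - lo κ).toNat : ℕ) : ℝ) * ((((F.P K).d - 1 : ℕ) : ℝ) * n * δ + 60 * ((((F.P K).d + 2) * (F.P K).L : ℕ) : ℝ) * ((F.P K).L : ℝ) * R)) ^ 2 +
        20 * (((∑ κ, (hi κ - lo κ).toNat : ℕ) : ℝ) * ((((F.P K).d - 1 : ℕ) : ℝ) * n * δ + 60 * ((((F.P K).d + 2) * (F.P K).L : ℕ) : ℝ) * ((F.P K).L : ℝ) * R)) *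
          ((((F.P K).d - 1 : ℕ) : ℝ) * n * δ) := by
  have hdat : Averaging.iter (avOfRecord F N K) j (gaugeAct u₀ U₁) = V := hbg.1
  have h := norm_mlog_iter_avOfRecord_centred_sub_le_supplied F N K k D hDk hcollar hw hR hguard hA u₀ U₁ hUA hj hn hnN hbox hS₀ (hdat ▸ hV) hδ hσ hv40 hs ht
  rw [hdat] at h
  exact h

/-- ★★★ **THE PER-DATUM CAPSTONE ON THE TOP CUBE OF THE CUBE TOWER, everything supplied that the lineage can supply**: `D := cubeDomains (F.P K) a M ρ k hk` (`1 ≤ k ≤ m + K`), box = the top cube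
`[sqLo k, sqHi k]`, chart keyed on the tower, `a := 60ℓLR`, `hdata` by the tower gauge, `hbox` by `hbox_cubeDomains_top` — displayed: the tower's collar, the chart binders, the (7)-smallness of
`M^k(U₁^{u₀})` on the top cube's plaquettes, the cube's extent `sqHi ≤ sqLo + n`, non-wrapping `n + 1 < N_k`, the thresholds.
[cite: Balaban1985Variational, (144) p.300, (147) p.301, (151)–(156) pp.301–302, (160) p.303; Balaban1985RegularSpaces, (1.131) p.99] -/
theorem norm_mlog_iter_avOfRecord_centred_sub_le_supplied_cubeTop (K : ℕ) {a : Pt (F.P K).d} {M ρ k : ℕ} {hk : k ≤ (F.P K).m + (F.P K).K} (hk1 : 1 ≤ k)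
    (hcollar : ∀ (i : ℕ) (e : PBond (F.P K) (i + 1)), (cubeDomains (F.P K) a M ρ k hk).LamBond (i + 1) e →
      ∀ z : Site (F.P K) i, (blockOf z = e.src ∨ blockOf z = e.tgt) → z ∈ (cubeDomains (F.P K) a M ρ k hk).Om i)
    {w : ℕ → PBond (F.P K) 0 → ℝ} (hw : IsLevWeight (F.P K) k (cubeDomains (F.P K) a M ρ k hk) w) {R : ℝ}
    (hR : 12800 * ((((F.P K).d + 2) * (F.P K).L : ℕ) : ℝ) ^ 2 * ((F.P K).L : ℝ) * R ≤ 1)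
    (hguard : 60 * ((((F.P K).d + 2) * (F.P K).L : ℕ) : ℝ) ^ 2 * ((F.P K).L : ℝ) * R < deltaSU (Fin N))
    {A : PBond (F.P K) 0 → MatA N} (hA : ∀ b, w 1 b * ‖A b‖ < R)
    (u₀ : GaugeTransf (F.P K) 0 (SU N)) (U₁ : GaugeField (F.P K) 0 (SU N))
    (hUA : ∀ b, ((U₁ b : SU N) : MatA N) = ((expCfg ((((F.P K).L : ℝ)⁻¹) ^ k) A b : (MatA N)ˣ) : MatA N))
    {n : ℕ} (hn : ∀ κ, sqHi (F.P K).L a M ρ k k κ ≤ sqLo (F.P K).L a ρ k k κ + n) (hnN : n + 1 < (F.P K).sitesPerDir k)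
    {δ : ℝ} {S₀ : Set (Plaq (F.P K) k)} (hS₀ : boxPlaqs (sqLo (F.P K).L a ρ k k) (sqHi (F.P K).L a M ρ k k) ⊆ S₀)
    (hV : PlaqSmallOn S₀ δ (Averaging.iter (avOfRecord F N K) k (gaugeAct u₀ U₁))) (hδ : 0 ≤ δ)
    (hσ : ((∑ κ, (sqHi (F.P K).L a M ρ k k κ - sqLo (F.P K).L a ρ k k κ).toNat : ℕ) : ℝ) *
        ((((F.P K).d - 1 : ℕ) : ℝ) * n * δ + 60 * ((((F.P K).d + 2) * (F.P K).L : ℕ) : ℝ) * ((F.P K).L : ℝ) * R) ≤ 1 / 80)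
    (hv40 : (((F.P K).d - 1 : ℕ) : ℝ) * n * δ ≤ 1 / 40)
    {c : PBond (F.P K) k} (hs : c.src ∈ (castSite '' Set.Icc (sqLo (F.P K).L a ρ k k) (sqHi (F.P K).L a M ρ k k) : Set (Site (F.P K) k)))
    (ht : c.tgt ∈ (castSite '' Set.Icc (sqLo (F.P K).L a ρ k k) (sqHi (F.P K).L a M ρ k k) : Set (Site (F.P K) k))) :
    ‖mlog ((Averaging.iter (avOfRecord F N K) k U₁ c : SU N) : MatA N) -
        (mlog ((((toMS (fun x => blockLift k (axialGauge (Averaging.iter (avOfRecord F N K) k (gaugeAct u₀ U₁)) (sqLo (F.P K).L a ρ k k) (sqHi (F.P K).L a M ρ k k)) x * u₀ x) k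
                  (castSite (sqLo (F.P K).L a ρ k k)))⁻¹ *
              Averaging.iter (avOfRecord F N K) k
                (gaugeAct (fun x => blockLift k (axialGauge (Averaging.iter (avOfRecord F N K) k (gaugeAct u₀ U₁)) (sqLo (F.P K).L a ρ k k) (sqHi (F.P K).L a M ρ k k)) x * u₀ x) U₁) c *
              toMS (fun x => blockLift k (axialGauge (Averaging.iter (avOfRecord F N K) k (gaugeAct u₀ U₁)) (sqLo (F.P K).L a ρ k k) (sqHi (F.P K).L a M ρ k k)) x * u₀ x) k
                (castSite (sqLo (F.P K).L a ρ k k)) : SU N)) : MatA N) +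
          (mlog (((((toMS (fun x => blockLift k (axialGauge (Averaging.iter (avOfRecord F N K) k (gaugeAct u₀ U₁)) (sqLo (F.P K).L a ρ k k) (sqHi (F.P K).L a M ρ k k)) x * u₀ x) k
                    (castSite (sqLo (F.P K).L a ρ k k)))⁻¹ *
                toMS (fun x => blockLift k (axialGauge (Averaging.iter (avOfRecord F N K) k (gaugeAct u₀ U₁)) (sqLo (F.P K).L a ρ k k) (sqHi (F.P K).L a M ρ k k)) x * u₀ x) k
                  c.src)⁻¹ : SU N)) : MatA N) -
            mlog (((((toMS (fun x => blockLift k (axialGauge (Averaging.iter (avOfRecord F N K) k (gaugeAct u₀ U₁)) (sqLo (F.P K).L a ρ k k) (sqHi (F.P K).L a M ρ k k)) x * u₀ x) k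
                    (castSite (sqLo (F.P K).L a ρ k k)))⁻¹ *
                toMS (fun x => blockLift k (axialGauge (Averaging.iter (avOfRecord F N K) k (gaugeAct u₀ U₁)) (sqLo (F.P K).L a ρ k k) (sqHi (F.P K).L a M ρ k k)) x * u₀ x) k
                  c.tgt)⁻¹ : SU N)) : MatA N)))‖ ≤
      8 * (((∑ κ, (sqHi (F.P K).L a M ρ k k κ - sqLo (F.P K).L a ρ k k κ).toNat : ℕ) : ℝ) *
            ((((F.P K).d - 1 : ℕ) : ℝ) * n * δ + 60 * ((((F.P K).d + 2) * (F.P K).L : ℕ) : ℝ) * ((F.P K).L : ℝ) * R)) ^ 2 +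
        20 * (((∑ κ, (sqHi (F.P K).L a M ρ k k κ - sqLo (F.P K).L a ρ k k κ).toNat : ℕ) : ℝ) *
            ((((F.P K).d - 1 : ℕ) : ℝ) * n * δ + 60 * ((((F.P K).d + 2) * (F.P K).L : ℕ) : ℝ) * ((F.P K).L : ℝ) * R)) *
          ((((F.P K).d - 1 : ℕ) : ℝ) * n * δ) :=
  norm_mlog_iter_avOfRecord_centred_sub_le_supplied F N K k (cubeDomains (F.P K) a M ρ k hk) rfl hcollar hw hR hguard hA u₀ U₁ hUA hk hn hnN
    (hbox_cubeDomains_top hk1) hS₀ hV hδ hσ hv40 hs ht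

/-- ★★★★ **THE KNIT-SHAPED PER-DATUM CAPSTONE ON THE TOP CUBE**: `D := cubeDomains (F.P K) a M ρ k hk` (`1 ≤ k ≤ m + K`), box = the top cube `[sqLo k, sqHi k]`, the tower representative `U′`,
the pair `(u, U₁)` with `U₁^{u} = U′^{h̄}` READ in the chart keyed on the tower — `a`, `hdata`, `hbox` ALL supplied; displayed: the tower's collar, the chart binders, `hrep`, the (7)-smallness of
`M^k U′` on the top cube's plaquettes, the cube's extent∕non-wrapping, the thresholds. [cite: Balaban1985Variational, (144) p.300, (147) p.301, (151)–(156) pp.301–302, (160) p.303; Balaban1985RegularSpaces, (1.131) p.99] -/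
theorem norm_mlog_iter_avOfRecord_centred_sub_le_supplied_of_rep_cubeTop (K : ℕ) {a : Pt (F.P K).d} {M ρ k : ℕ} {hk : k ≤ (F.P K).m + (F.P K).K} (hk1 : 1 ≤ k)
    (hcollar : ∀ (i : ℕ) (e : PBond (F.P K) (i + 1)), (cubeDomains (F.P K) a M ρ k hk).LamBond (i + 1) e →
      ∀ z : Site (F.P K) i, (blockOf z = e.src ∨ blockOf z = e.tgt) → z ∈ (cubeDomains (F.P K) a M ρ k hk).Om i)
    {w : ℕ → PBond (F.P K) 0 → ℝ} (hw : IsLevWeight (F.P K) k (cubeDomains (F.P K) a M ρ k hk) w) {R : ℝ}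
    (hR : 12800 * ((((F.P K).d + 2) * (F.P K).L : ℕ) : ℝ) ^ 2 * ((F.P K).L : ℝ) * R ≤ 1)
    (hguard : 60 * ((((F.P K).d + 2) * (F.P K).L : ℕ) : ℝ) ^ 2 * ((F.P K).L : ℝ) * R < deltaSU (Fin N))
    {A : PBond (F.P K) 0 → MatA N} (hA : ∀ b, w 1 b * ‖A b‖ < R)
    (U' : GaugeField (F.P K) 0 (SU N)) (u : GaugeTransf (F.P K) 0 (SU N)) (U₁ : GaugeField (F.P K) 0 (SU N))
    (hUA : ∀ b, ((U₁ b : SU N) : MatA N) = ((expCfg ((((F.P K).L : ℝ)⁻¹) ^ k) A b : (MatA N)ˣ) : MatA N))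
    {n : ℕ} (hn : ∀ κ, sqHi (F.P K).L a M ρ k k κ ≤ sqLo (F.P K).L a ρ k k κ + n) (hnN : n + 1 < (F.P K).sitesPerDir k)
    (hrep : gaugeAct u U₁ = gaugeAct (blockLift k (axialGauge (Averaging.iter (avOfRecord F N K) k U') (sqLo (F.P K).L a ρ k k) (sqHi (F.P K).L a M ρ k k))) U')
    {δ : ℝ} {S₀ : Set (Plaq (F.P K) k)} (hS₀ : boxPlaqs (sqLo (F.P K).L a ρ k k) (sqHi (F.P K).L a M ρ k k) ⊆ S₀)
    (hV : PlaqSmallOn S₀ δ (Averaging.iter (avOfRecord F N K) k U')) (hδ : 0 ≤ δ)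
    (hσ : ((∑ κ, (sqHi (F.P K).L a M ρ k k κ - sqLo (F.P K).L a ρ k k κ).toNat : ℕ) : ℝ) *
        ((((F.P K).d - 1 : ℕ) : ℝ) * n * δ + 60 * ((((F.P K).d + 2) * (F.P K).L : ℕ) : ℝ) * ((F.P K).L : ℝ) * R) ≤ 1 / 80)
    (hv40 : (((F.P K).d - 1 : ℕ) : ℝ) * n * δ ≤ 1 / 40)
    {c : PBond (F.P K) k} (hs : c.src ∈ (castSite '' Set.Icc (sqLo (F.P K).L a ρ k k) (sqHi (F.P K).L a M ρ k k) : Set (Site (F.P K) k)))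
    (ht : c.tgt ∈ (castSite '' Set.Icc (sqLo (F.P K).L a ρ k k) (sqHi (F.P K).L a M ρ k k) : Set (Site (F.P K) k))) :
    ‖mlog ((Averaging.iter (avOfRecord F N K) k U₁ c : SU N) : MatA N) -
        (mlog ((((toMS u k (castSite (sqLo (F.P K).L a ρ k k)))⁻¹ * Averaging.iter (avOfRecord F N K) k (gaugeAct u U₁) c *
              toMS u k (castSite (sqLo (F.P K).L a ρ k k)) : SU N)) : MatA N) +
          (mlog (((((toMS u k (castSite (sqLo (F.P K).L a ρ k k)))⁻¹ * toMS u k c.src)⁻¹ : SU N)) : MatA N) -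
            mlog (((((toMS u k (castSite (sqLo (F.P K).L a ρ k k)))⁻¹ * toMS u k c.tgt)⁻¹ : SU N)) : MatA N)))‖ ≤
      8 * (((∑ κ, (sqHi (F.P K).L a M ρ k k κ - sqLo (F.P K).L a ρ k k κ).toNat : ℕ) : ℝ) *
            ((((F.P K).d - 1 : ℕ) : ℝ) * n * δ + 60 * ((((F.P K).d + 2) * (F.P K).L : ℕ) : ℝ) * ((F.P K).L : ℝ) * R)) ^ 2 +
        20 * (((∑ κ, (sqHi (F.P K).L a M ρ k k κ - sqLo (F.P K).L a ρ k k κ).toNat : ℕ) : ℝ) *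
            ((((F.P K).d - 1 : ℕ) : ℝ) * n * δ + 60 * ((((F.P K).d + 2) * (F.P K).L : ℕ) : ℝ) * ((F.P K).L : ℝ) * R)) *
          ((((F.P K).d - 1 : ℕ) : ℝ) * n * δ) :=
  norm_mlog_iter_avOfRecord_centred_sub_le_supplied_of_rep F N K k (cubeDomains (F.P K) a M ρ k hk) rfl hcollar hw hR hguard hA U' u U₁ hUA hk hn hnN hrep
    (hbox_cubeDomains_top hk1) hS₀ hV hδ hσ hv40 hs ht

end Summit.QuantumFields.YangMills.BalabanUVNodes.N07ShearSizeTopBoxSupplied
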